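import Literature.MathematicalPhysics.QuantumFieldTheory.Balaban1983to89.B9WalkLettersOps310Facts
import Literature.MathematicalPhysics.QuantumFieldTheory.Balaban1983to89.B9BackgroundsKLevelV1R
import Literature.MathematicalPhysics.QuantumFieldTheory.Balaban1983to89.B9Ineq349SiteFromConv342
import Literature.MathematicalPhysics.QuantumFieldTheory.Balaban1983to89.B9CoReadingCoordsTranspose

/-!
# BalabanUVNodes ∕ N06 ([B9], `Dag.B9_main`) — W-b AT THE RECORD: `Identities310₂` OF THE rows-19 BOND-SECTOR WALK LETTERS `ops310WalkYO` READ FROM A (3.35)-MEMBERSHIP OF THE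
# CERTIFICATE's CARRIER `bg9YR M_N(ℂ) SU(N) R₁ R₂` — the A-side twin of `N06WalkLettersAtRecordROPar.identities₂_opsWalkYO_of_reg335R_laws` (HOME `pub-ymgap-dag-n06-d/W-b-PLAN.md`)
Track A of `YM-PLAN.md` (cell `pub-ymgap`, HUMAN RULING D-0062), node **N06**.  Seat `pub-ymgap-dag-n06-d` g31.
WHAT.  The Literature theorem ✓`B9WalkLettersOps310Facts.identities310₂_ops310WalkYO_of_laws` asks the bond variables to be CONTRACTION PAIRS (`‖U‖ ≤ 1`, `‖U⁻¹‖ ≤ 1`); at the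
certificate's carrier `bg9YR (Matrix (Fin N) (Fin N) ℂ) (specialUnitaryUnits (Fin N)) R₁ R₂ x` (`cfg := id`, `b := trBasis N`) this is READ from a (3.35)-membership `Reg335 c α₀ U`
through `MemOfFam SU(N) R₁` (`mem_of_reg335R`, `specialUnitaryUnits_le_unitaryUnits`, `norm_le_one_of_mem_unitaryUnits`) — exactly as the site side does
(`N06WalkLettersAtRecordROPar`).  ★ `identities310₂_ops310WalkYO_of_reg335R_laws`: ALL of `B9Thm310WholeDir.Identities310₂` for `ops310WalkYO ∕ dirOps310WalkYO ∕ dirLetters310WalkYO` at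
such a `U`, the four U-laws `inv ∕ invT ∕ eq3105 ∕ eq3105T` of the generic letters `GA ∕ Δa ∕ Oc ∕ Rf ∕ Rt` being HYPOTHESES (the shape of the knit certificate's rows-19
`Identities310₂` slot after the W-b edition).
HONEST FRAMING.  Helper (kernel bookkeeping over landed theorems), COUNT-NEUTRAL (`--supports stmt-QuantumFields-27239 --as helper`); the laws of `bI`, the four U-laws and the
membership are displayed; nothing of [B9] asserted; N06 NOT discharged; K1 NOT closed; nothing continuum ∕ OS ∕ mass gap ∕ Clay.  0 `def`, 0 `sorry`.  NEW file.
[cite: Balaban1985BackgroundPropagators, (3.35) p.396, (3.87) p.409, (3.100) p.413, (3.105)–(3.106) p.414; Balaban1984PropagatorsII, (2.39)–(2.44) pp.229–230, (2.51) p.232]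
-/
noncomputable section

namespace Summit.QuantumFields.YangMills.BalabanUVNodes.N06WalkLetters310AtRecordR
open Literature.MathematicalPhysics.QuantumFieldTheory.Balaban1983to89
open Literature.MathematicalPhysics.QuantumFieldTheory.Balaban1983to89.Node00
open Literature.MathematicalPhysics.QuantumFieldTheory.Balaban1983to89.B6Ineq2142KLevelV1 (β)
open Literature.MathematicalPhysics.QuantumFieldTheory.Balaban1983to89.B6GlobalChartV1 (PV blkV1)
open Literature.MathematicalPhysics.QuantumFieldTheory.Balaban1983to89.B6Cover236MultiLevelBlocks (cubes)
open Literature.MathematicalPhysics.QuantumFieldTheory.Balaban1983to89.B9PinMembersKLevelV1 (MemberY geo9Y)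
open Literature.MathematicalPhysics.QuantumFieldTheory.Balaban1983to89.B7Prop2SpecialUnitary (specialUnitaryUnits specialUnitaryUnits_le_unitaryUnits)
open Literature.MathematicalPhysics.QuantumFieldTheory.Balaban1983to89.B7Prop2Explicit (unitaryUnits)
open Literature.MathematicalPhysics.QuantumFieldTheory.Balaban1983to89.B9Thm310WholeDir (Identities310₂)
open Literature.MathematicalPhysics.QuantumFieldTheory.Balaban1983to89.B9Thm37Sum (mulOp)
open Literature.MathematicalPhysics.QuantumFieldTheory.Balaban1983to89.B9CoReadingCoords (XBK GcoK)
open Literature.MathematicalPhysics.QuantumFieldTheory.Balaban1983to89.B9CoReadingCoordsTranspose (TrIdx trBasis)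
open Literature.MathematicalPhysics.QuantumFieldTheory.Balaban1983to89.B9BackgroundsKLevelV1R (RegFamY MemOfFam bg9YR mem_of_reg335R)
open Literature.MathematicalPhysics.QuantumFieldTheory.Balaban1983to89.B9Ineq349SiteFromConv342 (norm_le_one_of_mem_unitaryUnits)
open Literature.MathematicalPhysics.QuantumFieldTheory.Balaban1983to89.B9WalkLettersOps310 (hWalkBY ops310WalkYO dirOps310WalkYO dirLetters310WalkYO)
open Literature.MathematicalPhysics.QuantumFieldTheory.Balaban1983to89.B9WalkLettersOps310Facts (identities310₂_ops310WalkYO_of_laws)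
open scoped Matrix.Norms.L2Operator
variable {d ℓ : ℕ} {hd : 1 ≤ d + 1} {hL : Odd (ℓ + 1) ∧ 1 < ℓ + 1} {b₀ b₁ : ℝ} {Mstar : ℕ} {N : ℕ}
variable (x : MemberY d ℓ hd hL b₀ b₁ Mstar) [Fintype (geo9Y x).Site]

/-- ★ **`Identities310₂` OF THE BOND-SECTOR WALK LETTERS OF RECORD, READ FROM A (3.35)-MEMBERSHIP OF THE CERTIFICATE's CARRIER** (`cfg := id`, `b := trBasis N`): the bond variables of
a `Reg335 c α₀ U`-configuration of `bg9YR M_N(ℂ) SU(N) R₁ R₂ x` lie in `SU(N) ⊂ U(N)`, hence are contraction pairs, so ✓`identities310₂_ops310WalkYO_of_laws` applies; the laws `hβ1 ∕ hbI0`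
of the bond map and the four U-laws `hinv ∕ hinvT ∕ h3105 ∕ h3105T` of the generic letters are HYPOTHESES.
[cite: Balaban1985BackgroundPropagators, (3.35) p.396, (3.100) p.413, (3.105)–(3.106) p.414, (3.27) p.395; Balaban1984PropagatorsII, (2.39)–(2.44) pp.229–230, (2.51) p.232] -/
theorem identities310₂_ops310WalkYO_of_reg335R_laws {R₁ R₂ : RegFamY d ℓ hd hL b₀ b₁ Mstar (Matrix (Fin N) (Fin N) ℂ)}
    (hGR : MemOfFam (specialUnitaryUnits (Fin N)) R₁) (bI : FBondY x.toKIdx → IBondY x.toKIdx) {AA : Type} [Fintype AA]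
    (GA : BondOpY (Matrix (Fin N) (Fin N) ℂ) x.toKIdx) (Oc : ↥(cubes x.toKIdx.D.toDomains) → BondOpY (Matrix (Fin N) (Fin N) ℂ) x.toKIdx)
    (Δa : (bg9YR (Matrix (Fin N) (Fin N) ℂ) (specialUnitaryUnits (Fin N)) R₁ R₂ x).Cfg → Module.End ℝ (XBK (TrIdx N) x.toKIdx → ℝ))
    (Rf Rt : (bg9YR (Matrix (Fin N) (Fin N) ℂ) (specialUnitaryUnits (Fin N)) R₁ R₂ x).Cfg → AA → Module.End ℝ (XBK (TrIdx N) x.toKIdx → ℝ))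
    (SF : AA → Finset (geo9Y x).Site) (R : ℝ) (H : Prop)
    (hβ1 : ∀ f : FBondY x.toKIdx, (B6Geom246MultiLevelTorus.geomT x.D).dist (β x.hN x.D x.hk (bI f)) (blkV1 x.hN x.D f) ≤ 1)
    (hbI0 : ∀ (z : Site (PV d ℓ x.m x.K hd hL) 0) (μ : Fin (d + 1)), bI ⟨z, μ⟩ = bI ⟨z, 0⟩)
    {c α₀ : ℝ} {U : (bg9YR (Matrix (Fin N) (Fin N) ℂ) (specialUnitaryUnits (Fin N)) R₁ R₂ x).Cfg}
    (hU : (bg9YR (Matrix (Fin N) (Fin N) ℂ) (specialUnitaryUnits (Fin N)) R₁ R₂ x).Reg335 c α₀ U)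
    (hinv : GcoK x.toKIdx (trBasis N) (bg9YR (Matrix (Fin N) (Fin N) ℂ) (specialUnitaryUnits (Fin N)) R₁ R₂ x) (fun U => U) GA U * Δa U = 1)
    (hinvT : Δa U * GcoK x.toKIdx (trBasis N) (bg9YR (Matrix (Fin N) (Fin N) ℂ) (specialUnitaryUnits (Fin N)) R₁ R₂ x) (fun U => U) GA U = 1)
    (h3105 : Δa U * (∑ c', mulOp (hWalkBY (κ := TrIdx N) x c') *
        GcoK x.toKIdx (trBasis N) (bg9YR (Matrix (Fin N) (Fin N) ℂ) (specialUnitaryUnits (Fin N)) R₁ R₂ x) (fun U => U) (Oc c') U * mulOp (hWalkBY x c')) = 1 - ∑ a, Rf U a)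
    (h3105T : (∑ c', mulOp (hWalkBY (κ := TrIdx N) x c') *
        GcoK x.toKIdx (trBasis N) (bg9YR (Matrix (Fin N) (Fin N) ℂ) (specialUnitaryUnits (Fin N)) R₁ R₂ x) (fun U => U) (Oc c') U * mulOp (hWalkBY x c')) * Δa U = 1 - ∑ a, Rt U a) :
    Identities310₂ (ops310WalkYO x (trBasis N) (bg9YR (Matrix (Fin N) (Fin N) ℂ) (specialUnitaryUnits (Fin N)) R₁ R₂ x) (fun U => U) bI GA Oc Δa Rf Rt SF)
      (dirOps310WalkYO x (trBasis N) (bg9YR (Matrix (Fin N) (Fin N) ℂ) (specialUnitaryUnits (Fin N)) R₁ R₂ x) (fun U => U) bI GA Oc Δa Rf Rt SF)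
      (dirLetters310WalkYO x (trBasis N) (bg9YR (Matrix (Fin N) (Fin N) ℂ) (specialUnitaryUnits (Fin N)) R₁ R₂ x) (fun U => U) bI GA Oc Δa Rf Rt SF) R H U :=
  have h1 := fun (g : (Matrix (Fin N) (Fin N) ℂ)ˣ) (hg : g ∈ unitaryUnits (Matrix (Fin N) (Fin N) ℂ)) => norm_le_one_of_mem_unitaryUnits hg
  have hbox : ∀ (μ : Fin (d + 1)) (w : SiteY x.toKIdx), UboxY x.toKIdx U μ w ∈ unitaryUnits (Matrix (Fin N) (Fin N) ℂ) := fun μ _ =>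
    specialUnitaryUnits_le_unitaryUnits (mem_of_reg335R hGR x hU μ _)
  identities310₂_ops310WalkYO_of_laws x (trBasis N) (bg9YR (Matrix (Fin N) (Fin N) ℂ) (specialUnitaryUnits (Fin N)) R₁ R₂ x) (fun U => U) bI GA Oc Δa Rf Rt SF R H hβ1 hbI0 U
    (fun μ w => ⟨h1 _ (hbox μ w), h1 _ (Subgroup.inv_mem _ (hbox μ w))⟩) hinv hinvT h3105 h3105T

end Summit.QuantumFields.YangMills.BalabanUVNodes.N06WalkLetters310AtRecordR

end
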